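import Literature.NumberTheory.Automorphic.LeviConstantTermCenter
import Literature.NumberTheory.Automorphic.EnvelopingCenterMatrixPi
import Literature.NumberTheory.Automorphic.HarishChandraCenterFiniteType
import Mathlib.RingTheory.MvPolynomial.Basic
import Mathlib.RingTheory.IntegralClosure.IsIntegralClosure.Basic
import Mathlib.RingTheory.Polynomial.Basic
import HarnessLib

/-!
# The ideal of `Z(𝔤𝔩_k(K_∞))` of finite codimension annihilating the Levi functions of constant terms
(Harish-Chandra 1968, §4, Thm. 4; Moeglin–Waldspurger 1995, I.2.17; Borel–Jacquet 1979, 4.4)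

Topic `NumberTheory/Automorphic`; sequel of `LeviConstantTermCenter`, `EnvelopingCenterMatrixPi` and
`HarishChandraCenterFiniteType`. From the monic relations generator by generator
(`exists_monic_forall_leviFunLeft_realPlace`, …) we build, for each character `θ` of
`Z(𝔤𝔩_{k+l}(K_∞))`, an ideal `J ≤ Z(𝔤𝔩_k(K_∞))` of finite codimension killing the Levi functions
`leviFunLeft φ_P m₂` of the constant terms of all automorphic forms `φ` on `GL_{k+l}(𝔸_K)` of
character `θ` (and likewise on the second block).

* §1 (general archimedean datum `ι : H → G`): `relIdeal g Q`, the ideal of `Z(𝔤)` generated by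
  `Q_i(g_i)` for a family of central generators `g_i` and polynomials `Q_i`;
  `finite_quot_relIdeal` — **if the `g_i` generate `Z(𝔤)` and the `Q_i` are monic, `Z(𝔤)/J` is
  finite-dimensional** (it is generated by finitely many integral elements);
  `applyFree_eq_zero_of_mem_relIdeal` — if every multiple of each `Q_i(g_i)` kills the smooth
  function `L`, so does every central word in `J`;
  `isZFinite_of_ideal` — **a smooth function killed by an ideal of finite codimension of `Z(𝔤)` is
  `Z(𝔤)`-finite** (its `Z(𝔤)`-orbit is the image of `Z(𝔤)/J`).
* §2: `exists_generators_centerU` — **`Z(𝔤𝔩_m(K_∞))` is generated by finitely many elements,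
  each the image at a real or complex place of a central element of `U(𝔤𝔩_m(ℝ))` or `U(𝔤𝔩_m(ℂ))`**
  (`center_matrix_mixedSpace_le_adjoin`, `finiteType_center_real`, transported along `envOfMat`).
* §3: `exists_ideal_forall_leviFunLeft` / `_Right` — the ideals `J` as above.

Everything here is proved; the definition is `relIdeal`.

## References

* Harish-Chandra, *Automorphic forms on semisimple Lie groups*, LNM 62 (1968), §4, Thm. 4
  [HarishChandra1968].
* C. Moeglin, J.-L. Waldspurger, *Spectral decomposition and Eisenstein series* (1995), I.2.17
  [MoeglinWaldspurger1995].
* A. Borel, H. Jacquet, *Automorphic forms and automorphic representations* (1979), 4.3–4.4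
  [BorelJacquet1979].
-/

-- Mathlib idiom (Mathlib/Algebra/Lie/OfAssociative.lean); needed to mention Lie subalgebras of matrix algebras
attribute [local instance 100] LieRing.ofAssociativeRing

noncomputable section

open scoped Matrix MatrixGroups Classical ContDiff Polynomial
open NumberField IsDedekindDomain NumberField.mixedEmbedding UniversalEnvelopingAlgebra
open _root_.MeasureTheory

namespace Literature.NumberTheory.Automorphic

/-! ### 1. Ideals generated by monic relations on generators (general archimedean datum) -/

section General

variable {A : Type*} [NormedCommRing A] [NormedAlgebra ℝ A] [NormedAlgebra ℚ A] [CompleteSpace A]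
  [StarRing A] [FiniteDimensional ℝ A] {N : Type*} [Fintype N] [DecidableEq N] {H : RealMatrixGroup A N}
  {G : Type*} [Group G] (ι : H.carrier →* G)

omit [FiniteDimensional ℝ A] in
/-- `freeToEnveloping` is surjective (the proof of `freeToEnveloping_surjective` of
`AutomorphicRepsGLCuspidalSpectralSupport`, not imported). Dixmier, 2.1.1. [folklore] -/
private theorem freeToEnveloping_surjective'' : Function.Surjective (freeToEnveloping H) := by
  have hrange : (freeToEnveloping H).range = ⊤ := by
    rw [freeToEnveloping, ← Algebra.adjoin_range_eq_range_freeAlgebra_lift]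
    have hι : Set.range (UniversalEnvelopingAlgebra.ι ℝ : H.lie → UniversalEnvelopingAlgebra ℝ H.lie) =
        UniversalEnvelopingAlgebra.mkAlgHom ℝ H.lie '' Set.range (TensorAlgebra.ι ℝ (M := H.lie)) := by
      rw [← Set.range_comp]
      rfl
    rw [hι, ← AlgHom.map_adjoin, TensorAlgebra.adjoin_range_ι, Algebra.map_top, AlgHom.range_eq_top]
    exact RingCon.mkₐ_surjective _
  intro u
  have hu : u ∈ (freeToEnveloping H).range := hrange ▸ Algebra.mem_top
  exact hu

/-- On smooth functions the word action factors through `U(𝔤)` (pointwise form of the tree's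
`applyFree_congr`). Borel–Jacquet 1979, §1.5. [cite: BorelJacquet1979, §1.5] -/
theorem applyFree_eq_of_freeToEnveloping_eq {φ : G → ℂ} (hφ : IsArchSmooth ι φ) {p q : FreeAlgebra ℝ H.lie}
    (h : freeToEnveloping H p = freeToEnveloping H q) : applyFree ι p φ = applyFree ι q φ := by
  obtain ⟨ρ, hρ⟩ := exists_lieHom_lieDeriv ι
  rw [← coe_envelopingAction_freeToEnveloping_of_forall_eq ρ hρ p ⟨φ, (mem_archSmooth_iff ι _).2 hφ⟩,
    ← coe_envelopingAction_freeToEnveloping_of_forall_eq ρ hρ q ⟨φ, (mem_archSmooth_iff ι _).2 hφ⟩, h]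

omit [FiniteDimensional ℝ A] in
/-- The word action of a finite sum of words (the lemma `applyFree_finset_sum` of
`CentralDerivativesTranslationGL`, not imported). [folklore] -/
private theorem applyFree_finset_sum' {ι₀ : Type*} (s : Finset ι₀) (p : ι₀ → FreeAlgebra ℝ H.lie) (φ : G → ℂ) :
    applyFree ι (∑ i ∈ s, p i) φ = ∑ i ∈ s, applyFree ι (p i) φ := by
  induction s using Finset.induction_on with
  | empty =>
    rw [Finset.sum_empty, Finset.sum_empty]
    unfold applyFree
    rw [map_zero, Finsupp.sum_zero_index]
  | insert i s hi ih => rw [Finset.sum_insert hi, Finset.sum_insert hi, applyFree_add, ih]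

variable (H) in
/-- **The ideal of relations**: the ideal of `Z(𝔤)` generated by the `Q_i(g_i)` for a family of
central elements `g_i` and polynomials `Q_i ∈ ℝ[X]`. [folklore] -/
def relIdeal {ι₀ : Type*} (g : ι₀ → centerU H) (Q : ι₀ → ℝ[X]) : Ideal (centerU H) :=
  Ideal.span (Set.range fun i => Polynomial.aeval (g i) (Q i))

/-- Generation of a subalgebra by elements of itself, read off in the ambient algebra. [folklore] -/
theorem adjoin_range_eq_top_of_le {R B : Type*} [CommSemiring R] [Semiring B] [Algebra R B]
    {S : Subalgebra R B} {ι₀ : Type*} {g : ι₀ → S}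
    (h : S ≤ Algebra.adjoin R (Set.range fun i => (g i : B))) :
    Algebra.adjoin R (Set.range g) = ⊤ := by
  refine eq_top_iff.2 fun z _ => ?_
  have hz : (z : B) ∈ (Algebra.adjoin R (Set.range g)).map S.val := by
    rw [AlgHom.map_adjoin, ← Set.range_comp]
    exact h z.2
  obtain ⟨y, hy, hyz⟩ := Subalgebra.mem_map.1 hz
  have : y = z := Subtype.ext hyz
  rwa [← this]

omit [FiniteDimensional ℝ A] in
/-- **`Z(𝔤)/J` is finite-dimensional** when the `g_i` (finitely many) generate `Z(𝔤)` and the `Q_i`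
are monic: `Z(𝔤)/J` is a quotient of `ℝ[X_i]_i / (Q_i(X_i))_i`, which is generated by the finitely
many integral classes `X̄_i` (`Algebra.IsIntegral.finite`; the polynomial model keeps the ring
structure of the quotient canonical). Harish-Chandra 1968, §4 (proof of Thm. 4).
[cite: HarishChandra1968, §4, Theorem 4] -/
theorem finite_quot_relIdeal {ι₀ : Type*} [Finite ι₀] {g : ι₀ → centerU H}
    (hgen : Algebra.adjoin ℝ (Set.range g) = ⊤) {Q : ι₀ → ℝ[X]} (hQ : ∀ i, (Q i).Monic) :
    FiniteDimensional ℝ (centerU H ⧸ relIdeal H g Q) := by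
  set J := relIdeal H g Q with hJ
  -- the polynomial model `P = ℝ[X_i]`, `ev : X_i ↦ g_i` (surjective), `I₀ = (Q_i(X_i))`
  set ev : MvPolynomial ι₀ ℝ →ₐ[ℝ] centerU H := MvPolynomial.aeval (fun i => g i) with hev
  have hev_surj : Function.Surjective ev := by
    rw [← AlgHom.range_eq_top, hev, ← Algebra.adjoin_range_eq_range_aeval]
    exact hgen
  set I₀ : Ideal (MvPolynomial ι₀ ℝ) :=
    Ideal.span (Set.range fun i => Polynomial.aeval (MvPolynomial.X i : MvPolynomial ι₀ ℝ) (Q i)) with hI₀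
  -- `P ⧸ I₀` is finite over `ℝ`: generated by the integral classes of the `X_i`
  have hfinP : Module.Finite ℝ (MvPolynomial ι₀ ℝ ⧸ I₀) := by
    have hint : ∀ i, IsIntegral ℝ (Ideal.Quotient.mkₐ ℝ I₀ (MvPolynomial.X i)) := fun i =>
      ⟨Q i, hQ i, by
        rw [← Polynomial.aeval_def, Polynomial.aeval_algHom_apply, Ideal.Quotient.mkₐ_eq_mk,
          Ideal.Quotient.eq_zero_iff_mem]
        exact Ideal.subset_span ⟨i, rfl⟩⟩
    have htop : Algebra.adjoin ℝ (Set.range fun i => Ideal.Quotient.mkₐ ℝ I₀ (MvPolynomial.X i)) = ⊤ := by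
      have h : (Set.range fun i => Ideal.Quotient.mkₐ ℝ I₀ (MvPolynomial.X i : MvPolynomial ι₀ ℝ)) =
          Ideal.Quotient.mkₐ ℝ I₀ '' Set.range (MvPolynomial.X : ι₀ → MvPolynomial ι₀ ℝ) := by
        rw [← Set.range_comp]; rfl
      rw [h, Algebra.adjoin_image, MvPolynomial.adjoin_range_X, Algebra.map_top, AlgHom.range_eq_top]
      exact Ideal.Quotient.mkₐ_surjective ℝ I₀
    haveI : Algebra.FiniteType ℝ (MvPolynomial ι₀ ℝ ⧸ I₀) :=
      Algebra.FiniteType.of_surjective (Ideal.Quotient.mkₐ ℝ I₀) (Ideal.Quotient.mkₐ_surjective ℝ I₀)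
    haveI : Algebra.IsIntegral ℝ (MvPolynomial ι₀ ℝ ⧸ I₀) := by
      refine ⟨fun x => ?_⟩
      have hx : x ∈ Algebra.adjoin ℝ (Set.range fun i => Ideal.Quotient.mkₐ ℝ I₀ (MvPolynomial.X i)) := by
        rw [htop]; exact Algebra.mem_top
      exact (Algebra.adjoin_le (by rintro _ ⟨i, rfl⟩; exact hint i) :
        Algebra.adjoin ℝ (Set.range fun i => Ideal.Quotient.mkₐ ℝ I₀ (MvPolynomial.X i)) ≤
          integralClosure ℝ (MvPolynomial ι₀ ℝ ⧸ I₀)) hx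
    exact Algebra.IsIntegral.finite
  -- `ev` maps `I₀` into `J`
  have hmap : Ideal.map ev I₀ ≤ J := by
    rw [hI₀, Ideal.map_span]
    refine Ideal.span_le.2 ?_
    rintro _ ⟨_, ⟨i, rfl⟩, rfl⟩
    rw [SetLike.mem_coe, ← Polynomial.aeval_algHom_apply ev, hev, MvPolynomial.aeval_X]
    exact Ideal.subset_span ⟨i, rfl⟩
  -- the surjection `P ⧸ I₀ → Z ⧸ J`
  set F : MvPolynomial ι₀ ℝ →ₗ[ℝ] centerU H ⧸ J := ((Submodule.mkQ J).restrictScalars ℝ).comp ev.toLinearMap with hF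
  have hFI : I₀.restrictScalars ℝ ≤ LinearMap.ker F := fun x hx =>
    (LinearMap.mem_ker).2 ((Submodule.Quotient.mk_eq_zero J).2 (hmap (Ideal.mem_map_of_mem ev hx)))
  have hFs : Function.Surjective F := (Submodule.mkQ_surjective J).comp hev_surj
  haveI : Module.Finite ℝ (MvPolynomial ι₀ ℝ ⧸ I₀.restrictScalars ℝ) :=
    @Module.Finite.equiv ℝ _ _ _ _ _ _ _ hfinP (Submodule.Quotient.restrictScalarsEquiv ℝ I₀).symm
  refine Module.Finite.of_surjective ((I₀.restrictScalars ℝ).liftQ F hFI) ?_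
  rw [← LinearMap.range_eq_top, Submodule.range_liftQ, LinearMap.range_eq_top]
  exact hFs

/-- **Central words in the ideal of relations kill**: if `L` is smooth and every word whose image in
`U(𝔤)` is a multiple of some `Q_i(g_i)` kills `L`, then every central word whose image lies in
`J = (Q_i(g_i))_i` kills `L`. [folklore] -/
theorem applyFree_eq_zero_of_mem_relIdeal {ι₀ : Type*} [Fintype ι₀] {g : ι₀ → centerU H} {Q : ι₀ → ℝ[X]}
    {L : G → ℂ} (hL : IsArchSmooth ι L)
    (hkill : ∀ (i : ι₀) (p : FreeAlgebra ℝ H.lie) (r : UniversalEnvelopingAlgebra ℝ H.lie),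
      freeToEnveloping H p = r * Polynomial.aeval ((g i : centerU H) : UniversalEnvelopingAlgebra ℝ H.lie) (Q i) →
        applyFree ι p L = 0)
    {p : FreeAlgebra ℝ H.lie} (hp : IsCentralWord p) (hpJ : (⟨freeToEnveloping H p, hp⟩ : centerU H) ∈ relIdeal H g Q) :
    applyFree ι p L = 0 := by
  obtain ⟨c, hc⟩ := Ideal.mem_span_range_iff_exists_fun.1 hpJ
  -- words for the summands
  choose pw hpw using fun i => freeToEnveloping_surjective'' (H := H)
    (((c i : centerU H) : UniversalEnvelopingAlgebra ℝ H.lie) *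
      Polynomial.aeval ((g i : centerU H) : UniversalEnvelopingAlgebra ℝ H.lie) (Q i))
  have hsum : freeToEnveloping H p = freeToEnveloping H (∑ i, pw i) := by
    have h := congrArg (centerU H).val hc
    rw [map_sum] at h
    calc freeToEnveloping H p = (centerU H).val ⟨freeToEnveloping H p, hp⟩ := rfl
      _ = ∑ i, (centerU H).val (c i * Polynomial.aeval (g i) (Q i)) := h.symm
      _ = ∑ i, freeToEnveloping H (pw i) := Finset.sum_congr rfl fun i _ => by
          rw [map_mul, hpw, ← Polynomial.aeval_algHom_apply]; rfl
      _ = freeToEnveloping H (∑ i, pw i) := (map_sum _ _ _).symm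
  rw [applyFree_eq_of_freeToEnveloping_eq ι hL hsum, applyFree_finset_sum', Finset.sum_eq_zero]
  intro i _
  exact hkill i (pw i) _ (hpw i)

/-- **A smooth function killed by an ideal of finite codimension of `Z(𝔤)` is `Z(𝔤)`-finite**: the
`Z(𝔤)`-orbit span of `φ` is the complex span of the image of the real-linear map `z ↦ z φ`, which
factors through the finite-dimensional `Z(𝔤)/J`. Borel–Jacquet 1979, 4.2 (c) ("it is equivalent to
require that `φ` be annihilated by an ideal of finite codimension"). [cite: BorelJacquet1979, 4.2 (c)] -/
theorem isZFinite_of_ideal {φ : G → ℂ} (hφ : IsArchSmooth ι φ) (J : Ideal (centerU H))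
    [FiniteDimensional ℝ (centerU H ⧸ J)]
    (hJ : ∀ (p : FreeAlgebra ℝ H.lie) (hp : IsCentralWord p),
      (⟨freeToEnveloping H p, hp⟩ : centerU H) ∈ J → applyFree ι p φ = 0) :
    IsZFinite ι φ := by
  obtain ⟨ρ, hρ⟩ := exists_lieHom_lieDeriv ι
  have hact := coe_envelopingAction_freeToEnveloping_of_forall_eq ρ hρ
  set φ' : archSmooth ι := ⟨φ, (mem_archSmooth_iff ι _).2 hφ⟩ with hφ'
  -- `z ↦ z φ`, real-linear on `Z(𝔤)`
  let T : centerU H →ₗ[ℝ] (G → ℂ) :=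
    { toFun := fun z => ((envelopingAction ρ (z : UniversalEnvelopingAlgebra ℝ H.lie) φ' : archSmooth ι) : G → ℂ)
      map_add' := fun z z' => by
        rw [Subalgebra.coe_add, map_add, LinearMap.add_apply, Submodule.coe_add]
      map_smul' := fun c z => by
        rw [Subalgebra.coe_smul, map_smul, LinearMap.smul_apply, Submodule.coe_smul_of_tower, RingHom.id_apply] }
  -- `T` kills `J`
  have hTJ : ∀ z ∈ J, T z = 0 := by
    intro z hz
    obtain ⟨p, hp⟩ := freeToEnveloping_surjective'' (H := H) (z : UniversalEnvelopingAlgebra ℝ H.lie)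
    have hpc : IsCentralWord p := by rw [IsCentralWord, hp]; exact z.2
    have hz' : (⟨freeToEnveloping H p, hpc⟩ : centerU H) ∈ J := by
      have : (⟨freeToEnveloping H p, hpc⟩ : centerU H) = z := Subtype.ext hp
      rwa [this]
    change ((envelopingAction ρ (z : UniversalEnvelopingAlgebra ℝ H.lie) φ' : archSmooth ι) : G → ℂ) = 0
    rw [← hp, hact, hJ p hpc hz']
  -- the orbit span is the complex span of the range of `T`, the image of `Z(𝔤)/J`
  have hle : zOrbitSpan ι φ ≤ Submodule.span ℂ (Set.range T) := by
    refine Submodule.span_le.2 ?_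
    rintro _ ⟨p, hp, rfl⟩
    refine Submodule.subset_span ⟨⟨freeToEnveloping H p, hp⟩, ?_⟩
    change ((envelopingAction ρ (freeToEnveloping H p) φ' : archSmooth ι) : G → ℂ) = applyFree ι p φ
    rw [hact]
  -- `range T` is a finite-dimensional real subspace (the image of `Z(𝔤)/J`)
  have hker : J.restrictScalars ℝ ≤ LinearMap.ker T := fun z hz => (LinearMap.mem_ker).2 (hTJ z hz)
  haveI : FiniteDimensional ℝ (centerU H ⧸ J.restrictScalars ℝ) :=
    @Module.Finite.equiv ℝ _ _ _ _ _ _ _ ‹FiniteDimensional ℝ (centerU H ⧸ J)›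
      (Submodule.Quotient.restrictScalarsEquiv ℝ J).symm
  haveI : FiniteDimensional ℝ (LinearMap.range T) := by
    rw [← Submodule.range_liftQ (J.restrictScalars ℝ) T hker]
    infer_instance
  obtain ⟨s, hs⟩ : (LinearMap.range T).FG := Module.Finite.iff_fg.mp inferInstance
  have hle' : Submodule.span ℂ (Set.range T) ≤ Submodule.span ℂ (s : Set (G → ℂ)) := by
    refine Submodule.span_le.2 ?_
    rintro _ ⟨z, rfl⟩
    have hz : T z ∈ Submodule.span ℝ (s : Set (G → ℂ)) := by
      rw [hs]; exact LinearMap.mem_range_self T z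
    exact Submodule.span_le_restrictScalars ℝ ℂ (s : Set (G → ℂ)) hz
  haveI : FiniteDimensional ℂ (Submodule.span ℂ (s : Set (G → ℂ))) :=
    FiniteDimensional.span_of_finite ℂ s.finite_toSet
  exact Submodule.finiteDimensional_of_le (hle.trans hle')

end General

variable {K : Type} [Field K] [NumberField K] {k l : ℕ}

/-! ### 2. Finitely many generators of `Z(𝔤𝔩_m(K_∞))`, place by place -/

section Generators

/-- `envToMat` maps the centre to the centre (it is an isomorphism). [folklore] -/
theorem envToMat_mem_center {m : ℕ} {z : UniversalEnvelopingAlgebra ℝ (archGroupGL m K).lie}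
    (hz : z ∈ Subalgebra.center ℝ (UniversalEnvelopingAlgebra ℝ (archGroupGL m K).lie)) :
    envToMat K m z ∈ Subalgebra.center ℝ (UniversalEnvelopingAlgebra ℝ (Matrix (Fin m) (Fin m) (mixedSpace K))) := by
  rw [Subalgebra.mem_center_iff]
  intro u
  have hu : u = envToMat K m (envOfMat K m u) := (envToMat_envOfMat u).symm
  rw [hu, ← map_mul, ← map_mul, Subalgebra.mem_center_iff.mp hz]

/-- **`Z(𝔤𝔩_m(K_∞))` has finitely many generators, each the image at a real or complex place of a
central element of `U(𝔤𝔩_m(ℝ))` resp. `U(𝔤𝔩_m(ℂ))`**: `Z(U(𝔤𝔩_m(K_∞))) = ⊗_w Z(U(𝔤𝔩_m(K_w)))`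
(`center_matrix_mixedSpace_le_adjoin`) and each factor is a finitely generated algebra
(`finiteType_center_real`, Harish-Chandra's isomorphism). Knapp 2002, Thm. 5.44; Dixmier 1996, 7.4.5.
[cite: Knapp2002, Thm. 5.44] -/
theorem exists_generators_centerU (m : ℕ) :
    ∃ (ι₀ : Type) (_ : Fintype ι₀) (g : ι₀ → centerU (archGroupGL m K)),
      Algebra.adjoin ℝ (Set.range g) = ⊤ ∧
      ∀ i, (∃ (w : {w : InfinitePlace K // w.IsReal}) (z : UniversalEnvelopingAlgebra ℝ (Matrix (Fin m) (Fin m) ℝ)),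
          z ∈ Subalgebra.center ℝ (UniversalEnvelopingAlgebra ℝ (Matrix (Fin m) (Fin m) ℝ)) ∧
            (g i : UniversalEnvelopingAlgebra ℝ (archGroupGL m K).lie) = envOfMat K m (HCLevi.mapU (realPlaceHom w) m z)) ∨
        (∃ (w : {w : InfinitePlace K // w.IsComplex}) (z : UniversalEnvelopingAlgebra ℝ (Matrix (Fin m) (Fin m) ℂ)),
          z ∈ Subalgebra.center ℝ (UniversalEnvelopingAlgebra ℝ (Matrix (Fin m) (Fin m) ℂ)) ∧
            (g i : UniversalEnvelopingAlgebra ℝ (archGroupGL m K).lie) = envOfMat K m (HCLevi.mapU (complexPlaceHom w) m z)) := by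
  haveI := finiteType_center_real ℝ m
  haveI := finiteType_center_real ℂ m
  obtain ⟨sR, hsR⟩ := Algebra.FiniteType.out (R := ℝ)
    (A := Subalgebra.center ℝ (UniversalEnvelopingAlgebra ℝ (Matrix (Fin m) (Fin m) ℝ)))
  obtain ⟨sC, hsC⟩ := Algebra.FiniteType.out (R := ℝ)
    (A := Subalgebra.center ℝ (UniversalEnvelopingAlgebra ℝ (Matrix (Fin m) (Fin m) ℂ)))
  let gR : {w : InfinitePlace K // w.IsReal} × (sR : Set (Subalgebra.center ℝ (UniversalEnvelopingAlgebra ℝ (Matrix (Fin m) (Fin m) ℝ)))) →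
      centerU (archGroupGL m K) := fun p =>
    ⟨envOfMat K m (HCLevi.mapU (realPlaceHom p.1) m (p.2.1 : UniversalEnvelopingAlgebra ℝ (Matrix (Fin m) (Fin m) ℝ))),
      envOfMat_mem_center (HCLevi.mapU_realPlace_mem_center p.1 p.2.1.2)⟩
  let gC : {w : InfinitePlace K // w.IsComplex} × (sC : Set (Subalgebra.center ℝ (UniversalEnvelopingAlgebra ℝ (Matrix (Fin m) (Fin m) ℂ)))) →
      centerU (archGroupGL m K) := fun p =>
    ⟨envOfMat K m (HCLevi.mapU (complexPlaceHom p.1) m (p.2.1 : UniversalEnvelopingAlgebra ℝ (Matrix (Fin m) (Fin m) ℂ))),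
      envOfMat_mem_center (HCLevi.mapU_complexPlace_mem_center p.1 p.2.1.2)⟩
  let g := Sum.elim gR gC
  refine ⟨_, inferInstance, g, ?_, ?_⟩
  · refine adjoin_range_eq_top_of_le ?_
    intro z hz
    have h1 := UEnvMatrix.center_matrix_mixedSpace_le_adjoin (K := K) (m := m) (envToMat_mem_center hz)
    have h2 : z ∈ (Algebra.adjoin ℝ _).map (envOfMat K m) := ⟨_, h1, envOfMat_envToMat z⟩
    rw [AlgHom.map_adjoin] at h2
    refine (Algebra.adjoin_le ?_ : Algebra.adjoin ℝ _ ≤ Algebra.adjoin ℝ (Set.range fun i => (g i : UniversalEnvelopingAlgebra ℝ (archGroupGL m K).lie))) h2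
    rintro _ ⟨t, ht, rfl⟩
    rcases ht with ht | ht
    · obtain ⟨w, hw⟩ := Set.mem_iUnion.1 ht
      obtain ⟨u, hu, rfl⟩ := hw
      have hu' : u ∈ Algebra.adjoin ℝ ((Subalgebra.center ℝ (UniversalEnvelopingAlgebra ℝ (Matrix (Fin m) (Fin m) ℝ))).val '' (sR : Set _)) := by
        rw [← AlgHom.map_adjoin, hsR, Algebra.map_top]; exact ⟨⟨u, hu⟩, rfl⟩
      have h3 : ((envOfMat K m).comp (HCLevi.mapU (realPlaceHom w) m)) u ∈
          (Algebra.adjoin ℝ ((Subalgebra.center ℝ (UniversalEnvelopingAlgebra ℝ (Matrix (Fin m) (Fin m) ℝ))).val '' (sR : Set _))).map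
            ((envOfMat K m).comp (HCLevi.mapU (realPlaceHom w) m)) := ⟨u, hu', rfl⟩
      rw [AlgHom.map_adjoin] at h3
      refine (Algebra.adjoin_le ?_ : _ ≤ Algebra.adjoin ℝ (Set.range fun i => (g i : UniversalEnvelopingAlgebra ℝ (archGroupGL m K).lie))) h3
      rintro _ ⟨_, ⟨z, hz, rfl⟩, rfl⟩
      exact Algebra.subset_adjoin ⟨Sum.inl (w, ⟨z, hz⟩), rfl⟩
    · obtain ⟨w, hw⟩ := Set.mem_iUnion.1 ht
      obtain ⟨u, hu, rfl⟩ := hw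
      have hu' : u ∈ Algebra.adjoin ℝ ((Subalgebra.center ℝ (UniversalEnvelopingAlgebra ℝ (Matrix (Fin m) (Fin m) ℂ))).val '' (sC : Set _)) := by
        rw [← AlgHom.map_adjoin, hsC, Algebra.map_top]; exact ⟨⟨u, hu⟩, rfl⟩
      have h3 : ((envOfMat K m).comp (HCLevi.mapU (complexPlaceHom w) m)) u ∈
          (Algebra.adjoin ℝ ((Subalgebra.center ℝ (UniversalEnvelopingAlgebra ℝ (Matrix (Fin m) (Fin m) ℂ))).val '' (sC : Set _))).map
            ((envOfMat K m).comp (HCLevi.mapU (complexPlaceHom w) m)) := ⟨u, hu', rfl⟩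
      rw [AlgHom.map_adjoin] at h3
      refine (Algebra.adjoin_le ?_ : _ ≤ Algebra.adjoin ℝ (Set.range fun i => (g i : UniversalEnvelopingAlgebra ℝ (archGroupGL m K).lie))) h3
      rintro _ ⟨_, ⟨z, hz, rfl⟩, rfl⟩
      exact Algebra.subset_adjoin ⟨Sum.inr (w, ⟨z, hz⟩), rfl⟩
  · rintro (⟨w, z⟩ | ⟨w, z⟩)
    · exact Or.inl ⟨w, _, z.1.2, rfl⟩
    · exact Or.inr ⟨w, _, z.1.2, rfl⟩

end Generators

/-! ### 3. The annihilating ideals of the Levi functions -/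

section Ideals

variable [MeasurableSpace (AdeleRing (𝓞 K) K)] [BorelSpace (AdeleRing (𝓞 K) K)]

/-- **The ideal of finite codimension of `Z(𝔤𝔩_k(K_∞))` annihilating the first Levi functions of the
constant terms of all automorphic forms of character `θ`**: for every character `θ` of
`Z(𝔤𝔩_{k+l}(K_∞))` there is an ideal `J ≤ Z(𝔤𝔩_k(K_∞))` of finite codimension such that for every
automorphic form `φ` on `GL_{k+l}(𝔸_K)` of character `θ`, every additive Haar measure `ν` on the
box and every `m₂`, every central word in `J` kills `leviFunLeft φ_P m₂`. Harish-Chandra 1968, §4,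
Thm. 4 and its corollary; Moeglin–Waldspurger 1995, I.2.17; Borel–Jacquet 1979, 4.4 ("`φ_P` is
`Z(𝔪)`-finite"). [cite: MoeglinWaldspurger1995, I.2.17] -/
theorem exists_ideal_forall_leviFunLeft {hcpt : isCompact_glFiniteIntegralLevel (k + l) K}
    (θ : centerU (archGroupGL (k + l) K) →ₐ[ℝ] ℂ) :
    ∃ J : Ideal (centerU (archGroupGL k K)), FiniteDimensional ℝ (centerU (archGroupGL k K) ⧸ J) ∧
      ∀ (φ : (AdelicGroupData.gl (k + l) K).Adelic → ℂ), IsAutomorphicForm (AutomorphyDatum.gl (k + l) K hcpt) φ →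
        HasZCharacter (glArch (k + l) K) φ θ →
        ∀ (ν : Measure (BlockIdx (k + l) k → AdeleRing (𝓞 K) K)) [ν.IsAddHaarMeasure]
          (m₂ : GL (Fin l) (AdeleRing (𝓞 K) K)) (p : FreeAlgebra ℝ (archGroupGL k K).lie) (hp : IsCentralWord p),
          (⟨freeToEnveloping (archGroupGL k K) p, hp⟩ : centerU (archGroupGL k K)) ∈ J →
            applyFree (glArch k K) p (leviFunLeft (blockCT (le_refl (k + l)) k ν φ) m₂) = 0 := by
  obtain ⟨ι₀, _, g, hgen, hg⟩ := exists_generators_centerU (K := K) k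
  -- the monic relations, generator by generator
  have hQ : ∀ i, ∃ Q : ℝ[X], Q.Monic ∧
      ∀ (φ : (AdelicGroupData.gl (k + l) K).Adelic → ℂ), IsAutomorphicForm (AutomorphyDatum.gl (k + l) K hcpt) φ →
        HasZCharacter (glArch (k + l) K) φ θ →
        ∀ (ν : Measure (BlockIdx (k + l) k → AdeleRing (𝓞 K) K)) [ν.IsAddHaarMeasure]
          (m₂ : GL (Fin l) (AdeleRing (𝓞 K) K)) (p : FreeAlgebra ℝ (archGroupGL k K).lie)
          (r : UniversalEnvelopingAlgebra ℝ (archGroupGL k K).lie),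
          freeToEnveloping (archGroupGL k K) p =
            r * Polynomial.aeval ((g i : centerU (archGroupGL k K)) : UniversalEnvelopingAlgebra ℝ (archGroupGL k K).lie) Q →
          applyFree (glArch k K) p (leviFunLeft (blockCT (le_refl (k + l)) k ν φ) m₂) = 0 := by
    intro i
    rcases hg i with ⟨w, z, hz, hgi⟩ | ⟨w, z, hz, hgi⟩
    · obtain ⟨Q, hQm, hQk⟩ := exists_monic_forall_leviFunLeft_realPlace (hcpt := hcpt) (l := l) w hz θ
      exact ⟨Q, hQm, fun φ hφ hθ ν _ m₂ p r hpr => hQk hφ hθ ν m₂ (by rw [hpr, hgi])⟩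
    · obtain ⟨Q, hQm, hQk⟩ := exists_monic_forall_leviFunLeft_complexPlace (hcpt := hcpt) (l := l) w hz θ
      exact ⟨Q, hQm, fun φ hφ hθ ν _ m₂ p r hpr => hQk hφ hθ ν m₂ (by rw [hpr, hgi])⟩
  choose Q hQm hQk using hQ
  refine ⟨relIdeal (archGroupGL k K) g Q, finite_quot_relIdeal hgen hQm, ?_⟩
  intro φ hφ hθ ν _ m₂ p hp hpJ
  have hL : IsArchSmooth (glArch k K) (leviFunLeft (blockCT (le_refl (k + l)) k ν φ) m₂) :=
    isArchSmooth_leviFunLeft (blockCT_smooth_unipotent_character hφ hθ ν).1 m₂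
  exact applyFree_eq_zero_of_mem_relIdeal (glArch k K) hL (fun i p r hpr => hQk i φ hφ hθ ν m₂ p r hpr) hp hpJ

/-- **The ideal of finite codimension of `Z(𝔤𝔩_l(K_∞))` annihilating the second Levi functions.**
[cite: MoeglinWaldspurger1995, I.2.17] -/
theorem exists_ideal_forall_leviFunRight {hcpt : isCompact_glFiniteIntegralLevel (k + l) K}
    (θ : centerU (archGroupGL (k + l) K) →ₐ[ℝ] ℂ) :
    ∃ J : Ideal (centerU (archGroupGL l K)), FiniteDimensional ℝ (centerU (archGroupGL l K) ⧸ J) ∧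
      ∀ (φ : (AdelicGroupData.gl (k + l) K).Adelic → ℂ), IsAutomorphicForm (AutomorphyDatum.gl (k + l) K hcpt) φ →
        HasZCharacter (glArch (k + l) K) φ θ →
        ∀ (ν : Measure (BlockIdx (k + l) k → AdeleRing (𝓞 K) K)) [ν.IsAddHaarMeasure]
          (m₁ : GL (Fin k) (AdeleRing (𝓞 K) K)) (p : FreeAlgebra ℝ (archGroupGL l K).lie) (hp : IsCentralWord p),
          (⟨freeToEnveloping (archGroupGL l K) p, hp⟩ : centerU (archGroupGL l K)) ∈ J →
            applyFree (glArch l K) p (leviFunRight (blockCT (le_refl (k + l)) k ν φ) m₁) = 0 := by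
  obtain ⟨ι₀, _, g, hgen, hg⟩ := exists_generators_centerU (K := K) l
  have hQ : ∀ i, ∃ Q : ℝ[X], Q.Monic ∧
      ∀ (φ : (AdelicGroupData.gl (k + l) K).Adelic → ℂ), IsAutomorphicForm (AutomorphyDatum.gl (k + l) K hcpt) φ →
        HasZCharacter (glArch (k + l) K) φ θ →
        ∀ (ν : Measure (BlockIdx (k + l) k → AdeleRing (𝓞 K) K)) [ν.IsAddHaarMeasure]
          (m₁ : GL (Fin k) (AdeleRing (𝓞 K) K)) (p : FreeAlgebra ℝ (archGroupGL l K).lie)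
          (r : UniversalEnvelopingAlgebra ℝ (archGroupGL l K).lie),
          freeToEnveloping (archGroupGL l K) p =
            r * Polynomial.aeval ((g i : centerU (archGroupGL l K)) : UniversalEnvelopingAlgebra ℝ (archGroupGL l K).lie) Q →
          applyFree (glArch l K) p (leviFunRight (blockCT (le_refl (k + l)) k ν φ) m₁) = 0 := by
    intro i
    rcases hg i with ⟨w, z, hz, hgi⟩ | ⟨w, z, hz, hgi⟩
    · obtain ⟨Q, hQm, hQk⟩ := exists_monic_forall_leviFunRight_realPlace (hcpt := hcpt) (k := k) w hz θ
      exact ⟨Q, hQm, fun φ hφ hθ ν _ m₁ p r hpr => hQk hφ hθ ν m₁ (by rw [hpr, hgi])⟩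
    · obtain ⟨Q, hQm, hQk⟩ := exists_monic_forall_leviFunRight_complexPlace (hcpt := hcpt) (k := k) w hz θ
      exact ⟨Q, hQm, fun φ hφ hθ ν _ m₁ p r hpr => hQk hφ hθ ν m₁ (by rw [hpr, hgi])⟩
  choose Q hQm hQk using hQ
  refine ⟨relIdeal (archGroupGL l K) g Q, finite_quot_relIdeal hgen hQm, ?_⟩
  intro φ hφ hθ ν _ m₁ p hp hpJ
  have hL : IsArchSmooth (glArch l K) (leviFunRight (blockCT (le_refl (k + l)) k ν φ) m₁) :=
    isArchSmooth_leviFunRight (blockCT_smooth_unipotent_character hφ hθ ν).1 m₁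
  exact applyFree_eq_zero_of_mem_relIdeal (glArch l K) hL (fun i p r hpr => hQk i φ hφ hθ ν m₁ p r hpr) hp hpJ

end Ideals


end Literature.NumberTheory.Automorphic
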